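import Mathlib
import HarnessLib
import Summits.Ventures.LatticeQCDFlow.Scoring.BlockMeanHeavyTailSigned

/-!
# UNBOUNDED signed observables at the `(1 + ε)` level: the printed self-normalised reweighting
# estimate is certified by the median over `R` blocks with `B₁ = ∫ p|O| dμ` in place of a sup
# bound — radius `(t + B₁u)/(1 − u)` at confidence `1 − e^{−R/8}` once `320A_O ≤ m^ε t^{1+ε}` and
# `40A₁ ≤ m^ε u^{1+ε}`

HONEST FRAMING: exact (Metropolis-corrected) sampling algorithms for lattice gauge theory;
figures of merit are autocorrelation/cost numbers at stated couplings and volumes; no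
continuum-physics claim.

Venture `LatticeQCDFlow` (cell pub-lqcd), topic `Scoring`; FANOUT row 4 (`s0-u1-b`, rung S0-B).
Sequel of `Scoring/BlockMeanHeavyTailSigned` (imported: the signed block-mean bound
`P(η ≤ |Ḡ_m − ∫ g|) ≤ 40A/(m^ε η^{1+ε})`, `A = ∫ |g|^{1+ε} dν`, `0 < ε ≤ 1`) and of row 4's
`Scoring/SelfNormalisedReweightingHeavyTail` (the printed estimate for a BOUNDED observable
`|O| ≤ B` via the shifted score `w(O + B)`; 'signed unbounded observables at the `(1 + ε)` level'
NOT CLAIMED there).  Here the observable is SIGNED and UNBOUNDED: the score `w·O` has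
`E_q |wO|^{1+ε} = A_O = ∫ p^{1+ε}|O|^{1+ε}/q^ε dμ` (stated as `Integrable`); that moment alone gives
`p·O ∈ L¹(μ)` and `|E_p O| ≤ B₁ = ∫ p|O| dμ`; per block, the unnormalised estimate `Ê_r` is within
`t` of `E_p O` except with probability `40A_O/(m^ε t^{1+ε})`, the mean weight `W̄_r` within `u` of
`1` except with probability `5A₁/(m^ε u^{1+ε})` (row 4's `meanWeight_heavyTail_iid`,
`A₁ = ∫ p^{1+ε}/q^ε dμ`), and row 8's ratio inequality (`Scoring.abs_div_sub_div_le`) turns the two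
into `|S_r − E_p O| < (t + B₁u)/(1 − u)` for the PRINTED `S_r = Σ w̃ⱼOⱼ/Σ w̃ⱼ` (any normalisation
`w̃ = c·w`, `c > 0`); row 4's median device concludes.  NEW WORK of the cell (elementary); no
definition; nothing cited as a fact.

## Content (`ν = μ.withDensity q`; `w = p/q`; `A_O = ∫ p^{1+ε}|O|^{1+ε}/q^ε dμ`;
## `A₁ = ∫ p^{1+ε}/q^ε dμ`; `B₁ ≥ ∫ p|O| dμ`)

* §1 the model: `abs_weightMul_rpow_mul_model` (`|wO|^{1+ε}·q = p^{1+ε}|O|^{1+ε}/q^ε`),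
  `integrable_abs_weightMul_rpow_model`, `integral_abs_weightMul_rpow_model`,
  **`integrable_targetMul_of_rpow`** (`p·O ∈ L¹(μ)`, `p|O| ∈ L¹(μ)`, `|E_p O| ≤ ∫ p|O| dμ`),
  **`reweighting_heavyTail_signed_iid`** (`P(t ≤ |Ê − E_p O|) ≤ 40A_O/(m^ε t^{1+ε})`);
* §2 **`selfNormReweighting_medianOfBlocks_confidence_heavyTail_unbounded`** — blocks of `m ≥ 1`,
  `R·m ≤ n`, `t > 0`, `0 < u < 1`, `320A_O ≤ m^ε t^{1+ε}`, `40A₁ ≤ m^ε u^{1+ε}`: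
  `P( #{r < R : (t + B₁u)/(1 − u) ≤ |S_r − ∫ p·O dμ|} ≥ R/2 ) ≤ exp(−R/8)`;
  `selfNormReweighting_sampleMedian_confidence_heavyTail_unbounded` (ANY sample-median selection).

Reading (value-free): an unbounded observable is certified from one run's printed blocks with three
population inputs — a `(1 + ε)`-th weight moment `A₁`, the mixed moment `A_O`, and the first
absolute target moment `B₁` — and no second moment of anything.  NOT CLAIMED: `ε > 1` (the `L²`
file `Scoring/ReweightingMedianOfBlocksUnbounded`); estimating `A_O`, `A₁`, `B₁` (inputs); the
optimal constant; any number of ours re-scored.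
-/

noncomputable section

namespace Summit.Ventures.LatticeQCDFlow.Scoring.HeavyTailMedian

open MeasureTheory ProbabilityTheory Finset Real Set
open Summit.Ventures.LatticeQCDFlow.Scoring.BlockMedian
open Summit.Ventures.LatticeQCDFlow.Scoring.AllPairsMedian
open Summit.Ventures.LatticeQCDFlow.Scoring.ReweightingMedian

/-! ## §1 The signed score `w·O` of an unbounded observable under the model law -/

section Model

variable {X : Type*} [MeasurableSpace X] {μ : Measure X} {p q O : X → ℝ} {ε : ℝ}

omit [MeasurableSpace X] in
/-- `|wO|^{1+ε}·q = p^{1+ε}|O|^{1+ε}/q^ε` pointwise (`p ≥ 0`, `q > 0`). [ours] -/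
theorem abs_weightMul_rpow_mul_model (hp0 : ∀ z, 0 ≤ p z) (hq0 : ∀ z, 0 < q z) (a : X) :
    |p a / q a * O a| ^ (1 + ε) * q a = p a ^ (1 + ε) * |O a| ^ (1 + ε) / q a ^ ε := by
  have hw0 : 0 ≤ p a / q a := div_nonneg (hp0 a) (hq0 a).le
  rw [abs_mul, abs_of_nonneg hw0, Real.mul_rpow hw0 (abs_nonneg _), mul_right_comm,
    weight_rpow_mul_model hp0 hq0 a]
  ring

/-- **`|wO|^{1+ε} ∈ L¹(q dμ)` from `p^{1+ε}|O|^{1+ε}/q^ε ∈ L¹(μ)`.** [ours] -/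
theorem integrable_abs_weightMul_rpow_model (hp0 : ∀ z, 0 ≤ p z) (hq0 : ∀ z, 0 < q z)
    (hqm : Measurable q)
    (hAOi : Integrable (fun z => p z ^ (1 + ε) * |O z| ^ (1 + ε) / q z ^ ε) μ) :
    Integrable (fun a => |p a / q a * O a| ^ (1 + ε))
      (μ.withDensity fun z => ENNReal.ofReal (q z)) := by
  rw [AllPairsVariance.integrable_withDensity_iff' (fun z => (hq0 z).le) hqm]
  have h : (fun a => |p a / q a * O a| ^ (1 + ε) * q a)
      = fun a => p a ^ (1 + ε) * |O a| ^ (1 + ε) / q a ^ ε :=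
    funext fun a => abs_weightMul_rpow_mul_model hp0 hq0 a
  rw [h]
  exact hAOi

/-- `E_ν |wO|^{1+ε} = ∫ p^{1+ε}|O|^{1+ε}/q^ε dμ = A_O`. [ours] -/
theorem integral_abs_weightMul_rpow_model (hp0 : ∀ z, 0 ≤ p z) (hq0 : ∀ z, 0 < q z)
    (hqm : Measurable q) :
    ∫ a, |p a / q a * O a| ^ (1 + ε) ∂(μ.withDensity fun z => ENNReal.ofReal (q z))
      = ∫ z, p z ^ (1 + ε) * |O z| ^ (1 + ε) / q z ^ ε ∂μ := by
  rw [AllPairsVariance.integral_withDensity_eq' (fun z => (hq0 z).le) hqm]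
  exact integral_congr_ae (Filter.Eventually.of_forall fun a =>
    abs_weightMul_rpow_mul_model hp0 hq0 a)

/-- **`p·O ∈ L¹(μ)` from the `(1 + ε)`-th moment** (when `q dμ` is a probability law), together
with `p|O| ∈ L¹(μ)` and `|E_p O| ≤ ∫ p|O| dμ`. [ours] -/
theorem integrable_targetMul_of_rpow
    (hν : IsProbabilityMeasure (μ.withDensity fun z => ENNReal.ofReal (q z)))
    (hp0 : ∀ z, 0 ≤ p z) (hpm : Measurable p) (hq0 : ∀ z, 0 < q z) (hqm : Measurable q)
    (hOm : Measurable O) (hε : 0 ≤ ε)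
    (hAOi : Integrable (fun z => p z ^ (1 + ε) * |O z| ^ (1 + ε) / q z ^ ε) μ) :
    Integrable (fun z => p z * O z) μ ∧ Integrable (fun z => p z * |O z|) μ
      ∧ |∫ z, p z * O z ∂μ| ≤ ∫ z, p z * |O z| ∂μ := by
  have hgm : Measurable fun a => p a / q a * O a := (hpm.div hqm).mul hOm
  have hgi : Integrable (fun a => p a / q a * O a)
      (μ.withDensity fun z => ENNReal.ofReal (q z)) :=
    integrable_of_abs_rpow_moment hgm hε (integrable_abs_weightMul_rpow_model hp0 hq0 hqm hAOi)
  have h1 : Integrable (fun z => p z * O z) μ := by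
    have h := (AllPairsVariance.integrable_withDensity_iff' (fun z => (hq0 z).le) hqm _).1 hgi
    have e : (fun a => p a / q a * O a * q a) = fun a => p a * O a := by
      funext a
      field_simp [(hq0 a).ne']
    rw [e] at h
    exact h
  have h2 : Integrable (fun z => p z * |O z|) μ := by
    have h := h1.abs
    have e : (fun z => |p z * O z|) = fun z => p z * |O z| := by
      funext z
      rw [abs_mul, abs_of_nonneg (hp0 z)]
    rw [e] at h
    exact h
  refine ⟨h1, h2, ?_⟩
  calc |∫ z, p z * O z ∂μ| ≤ ∫ z, |p z * O z| ∂μ := abs_integral_le_integral_abs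
    _ = ∫ z, p z * |O z| ∂μ := integral_congr_ae (Filter.Eventually.of_forall fun z => by
        show |p z * O z| = p z * |O z|
        rw [abs_mul, abs_of_nonneg (hp0 z)])

variable {Ω : Type*} [MeasurableSpace Ω] {P : Measure Ω} [IsProbabilityMeasure P] {m : ℕ}

/-- **THE UNNORMALISED REWEIGHTING BLOCK MEAN OF AN UNBOUNDED SIGNED OBSERVABLE** under the
`(1 + ε)`-th moment `A_O = ∫ p^{1+ε}|O|^{1+ε}/q^ε dμ`: `P(t ≤ |Ê − E_p O|) ≤ 40A_O/(m^ε t^{1+ε})`,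
`Ê = Σ_j w(x_j)O(x_j)/m`. [ours] -/
theorem reweighting_heavyTail_signed_iid {x : Fin m → Ω → X} (hxm : ∀ j, Measurable (x j))
    (hind : iIndepFun x P) (hp0 : ∀ z, 0 ≤ p z) (hpm : Measurable p) (hq0 : ∀ z, 0 < q z)
    (hqm : Measurable q) (hOm : Measurable O) (hε0 : 0 < ε) (hε1 : ε ≤ 1)
    (hAOi : Integrable (fun z => p z ^ (1 + ε) * |O z| ^ (1 + ε) / q z ^ ε) μ)
    (hlaw : ∀ j, Measure.map (x j) P = μ.withDensity fun z => ENNReal.ofReal (q z))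
    (hm : 1 ≤ m) {t : ℝ} (ht : 0 < t) :
    P.real {ω | t ≤ |(∑ j : Fin m, p (x j ω) / q (x j ω) * O (x j ω)) / m - ∫ z, p z * O z ∂μ|}
      ≤ 40 * (∫ z, p z ^ (1 + ε) * |O z| ^ (1 + ε) / q z ^ ε ∂μ)
          / ((m : ℝ) ^ ε * t ^ (1 + ε)) := by
  have h := blockMean_heavyTail_signed_iid (ν := μ.withDensity fun z => ENNReal.ofReal (q z))
    hxm hind hlaw (g := fun a => p a / q a * O a) ((hpm.div hqm).mul hOm) hε0 hε1
    (integrable_abs_weightMul_rpow_model hp0 hq0 hqm hAOi) hm ht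
  rw [integral_weightMul_model hq0 hqm, integral_abs_weightMul_rpow_model hp0 hq0 hqm] at h
  exact h

end Model

/-! ## §2 The printed self-normalised estimate of an unbounded observable -/

section Certificate

variable {Ω : Type*} [MeasurableSpace Ω] {P : Measure Ω} [IsProbabilityMeasure P]
variable {X : Type*} [MeasurableSpace X] {μ : Measure X} {p q O : X → ℝ} {ε : ℝ} {n m R : ℕ}

/-- **THE PRINTED SELF-NORMALISED ESTIMATE OF AN UNBOUNDED OBSERVABLE AT THE `(1 + ε)` LEVEL.**
`n` independent model draws `y_j` (laws `μ.withDensity q`); `p ≥ 0` measurable, integrable,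
`∫ p = 1`; `q > 0` measurable; `O` measurable (signed, unbounded); for some `0 < ε ≤ 1` the
moments `A₁ = ∫ p^{1+ε}/q^ε dμ` and `A_O = ∫ p^{1+ε}|O|^{1+ε}/q^ε dμ` are finite; `B₁` is any
bound `∫ p|O| dμ ≤ B₁`; weights printed with ANY normalisation `w̃ = c·p/q`, `c > 0`; blocks of
`m ≥ 1` draws, `R·m ≤ n`; `t > 0`, `0 < u < 1` with `320A_O ≤ m^ε t^{1+ε}` and
`40A₁ ≤ m^ε u^{1+ε}`.  With `S_r = Σ_j w̃_j O_j / Σ_j w̃_j`: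
`P( #{r < R : (t + B₁u)/(1 − u) ≤ |S_r − ∫ p·O dμ|} ≥ R/2 ) ≤ exp(−R/8)`. [ours] -/
theorem selfNormReweighting_medianOfBlocks_confidence_heavyTail_unbounded {y : Fin n → Ω → X}
    (hym : ∀ j, Measurable (y j)) (hind : iIndepFun y P) (hp0 : ∀ z, 0 ≤ p z)
    (hpm : Measurable p) (hpi : Integrable p μ) (hp1 : ∫ z, p z ∂μ = 1) (hq0 : ∀ z, 0 < q z)
    (hqm : Measurable q) (hOm : Measurable O) (hε0 : 0 < ε) (hε1 : ε ≤ 1)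
    (hA1i : Integrable (fun z => p z ^ (1 + ε) / q z ^ ε) μ)
    (hAOi : Integrable (fun z => p z ^ (1 + ε) * |O z| ^ (1 + ε) / q z ^ ε) μ) {B₁ : ℝ}
    (hB₁ : ∫ z, p z * |O z| ∂μ ≤ B₁)
    (hlaw : ∀ j, Measure.map (y j) P = μ.withDensity fun z => ENNReal.ofReal (q z))
    {wt : X → ℝ} {c : ℝ} (hc : 0 < c) (hwt : ∀ z, wt z = c * (p z / q z))
    (hm : 1 ≤ m) (hRm : R * m ≤ n) {t u : ℝ} (ht : 0 < t) (hu : 0 < u) (hu1 : u < 1)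
    (hvt : 320 * ∫ z, p z ^ (1 + ε) * |O z| ^ (1 + ε) / q z ^ ε ∂μ ≤ (m : ℝ) ^ ε * t ^ (1 + ε))
    (hvu : 40 * ∫ z, p z ^ (1 + ε) / q z ^ ε ∂μ ≤ (m : ℝ) ^ ε * u ^ (1 + ε)) :
    P.real {ω | (R : ℝ) / 2 ≤ #{r ∈ (univ : Finset (Fin R)) | (t + B₁ * u) / (1 - u) ≤
        |(∑ j : Fin m, wt (y ⟨((r : Fin R) : ℕ) * m + j, mul_add_lt hRm r j⟩ ω)
              * O (y ⟨((r : Fin R) : ℕ) * m + j, mul_add_lt hRm r j⟩ ω))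
            / (∑ j : Fin m, wt (y ⟨((r : Fin R) : ℕ) * m + j, mul_add_lt hRm r j⟩ ω))
          - ∫ z, p z * O z ∂μ|}} ≤ exp (-(R / 8)) := by
  rcases Nat.eq_zero_or_pos R with hR | hR
  · subst hR
    refine measureReal_le_one.trans ?_
    simp
  have hn : 0 < n := by
    have : 0 < R * m := Nat.mul_pos hR (by omega)
    omega
  haveI hν : IsProbabilityMeasure (μ.withDensity fun z => ENNReal.ofReal (q z)) :=
    isProbabilityMeasure_of_map_eq_iid (hym ⟨0, hn⟩) (hlaw ⟨0, hn⟩)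
  obtain ⟨hOi, hOabs, ha⟩ := integrable_targetMul_of_rpow hν hp0 hpm hq0 hqm hOm hε0.le hAOi
  have ha' : |∫ z, p z * O z ∂μ| ≤ B₁ := ha.trans hB₁
  have hB0 : 0 ≤ B₁ := (abs_nonneg _).trans ha'
  have hwtm : Measurable wt := by
    have : wt = fun z => c * (p z / q z) := funext hwt
    rw [this]
    exact (hpm.div hqm).const_mul c
  have hm0 : (0 : ℝ) < m := by exact_mod_cast hm
  have hDt : 0 < (m : ℝ) ^ ε * t ^ (1 + ε) :=
    mul_pos (Real.rpow_pos_of_pos hm0 _) (Real.rpow_pos_of_pos ht _)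
  have hDu : 0 < (m : ℝ) ^ ε * u ^ (1 + ε) :=
    mul_pos (Real.rpow_pos_of_pos hm0 _) (Real.rpow_pos_of_pos hu _)
  -- the printed block estimate as a measurable function of the block; independence across blocks
  have hg : Measurable fun (v : Fin m → X) =>
      (∑ j : Fin m, wt (v j) * O (v j)) / (∑ j : Fin m, wt (v j)) :=
    (Finset.measurable_sum _ fun (j : Fin m) _ =>
      (hwtm.comp (measurable_pi_apply j)).mul (hOm.comp (measurable_pi_apply j))).div
      (Finset.measurable_sum _ fun (j : Fin m) _ => hwtm.comp (measurable_pi_apply j))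
  have hYind : iIndepFun (fun (r : Fin R) ω =>
      (∑ j : Fin m, wt (y ⟨(r : ℕ) * m + j, mul_add_lt hRm r j⟩ ω)
            * O (y ⟨(r : ℕ) * m + j, mul_add_lt hRm r j⟩ ω))
        / (∑ j : Fin m, wt (y ⟨(r : ℕ) * m + j, mul_add_lt hRm r j⟩ ω))) P :=
    iIndepFun_blockFun hym hind hRm hg
  have hYm : ∀ r : Fin R, Measurable fun ω =>
      (∑ j : Fin m, wt (y ⟨(r : ℕ) * m + j, mul_add_lt hRm r j⟩ ω)
            * O (y ⟨(r : ℕ) * m + j, mul_add_lt hRm r j⟩ ω))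
        / (∑ j : Fin m, wt (y ⟨(r : ℕ) * m + j, mul_add_lt hRm r j⟩ ω)) := fun r => by
    have hblk : Measurable fun ω => fun (i : Fin m) => y ⟨(r : ℕ) * m + i, mul_add_lt hRm r i⟩ ω :=
      measurable_pi_lambda _ fun i => hym _
    exact hg.comp hblk
  -- each block is bad with probability ≤ 1/8 + 1/8
  have hfar : ∀ r ∈ (univ : Finset (Fin R)), P.real {ω | (t + B₁ * u) / (1 - u) ≤
      |(∑ j : Fin m, wt (y ⟨(r : ℕ) * m + j, mul_add_lt hRm r j⟩ ω)
            * O (y ⟨(r : ℕ) * m + j, mul_add_lt hRm r j⟩ ω))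
          / (∑ j : Fin m, wt (y ⟨(r : ℕ) * m + j, mul_add_lt hRm r j⟩ ω))
        - ∫ z, p z * O z ∂μ|} ≤ 1 / 4 := by
    intro r _
    have hE := reweighting_heavyTail_signed_iid
      (x := fun (i : Fin m) => y ⟨(r : ℕ) * m + i, mul_add_lt hRm r i⟩) (fun i => hym _)
      (iIndepFun_block hind hRm r) hp0 hpm hq0 hqm hOm hε0 hε1 hAOi (fun i => hlaw _) hm ht
    have hW := meanWeight_heavyTail_iid
      (x := fun (i : Fin m) => y ⟨(r : ℕ) * m + i, mul_add_lt hRm r i⟩) (fun i => hym _)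
      (iIndepFun_block hind hRm r) hp0 hpm hpi hp1 hq0 hqm hε0 hε1 hA1i (fun i => hlaw _) hm hu
    have hratio : ∀ ω,
        (∑ j : Fin m, wt (y ⟨(r : ℕ) * m + j, mul_add_lt hRm r j⟩ ω)
              * O (y ⟨(r : ℕ) * m + j, mul_add_lt hRm r j⟩ ω))
          / (∑ j : Fin m, wt (y ⟨(r : ℕ) * m + j, mul_add_lt hRm r j⟩ ω))
        = ((∑ j : Fin m, p (y ⟨(r : ℕ) * m + j, mul_add_lt hRm r j⟩ ω)
              / q (y ⟨(r : ℕ) * m + j, mul_add_lt hRm r j⟩ ω)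
              * O (y ⟨(r : ℕ) * m + j, mul_add_lt hRm r j⟩ ω)) / m)
          / ((∑ j : Fin m, p (y ⟨(r : ℕ) * m + j, mul_add_lt hRm r j⟩ ω)
              / q (y ⟨(r : ℕ) * m + j, mul_add_lt hRm r j⟩ ω)) / m) := fun ω => by
      rw [blockSelfNorm_scale_free hc hwt fun i => y ⟨(r : ℕ) * m + i, mul_add_lt hRm r i⟩ ω,
        blockSelfNorm_eq_div hm]
    have hsub : {ω | (t + B₁ * u) / (1 - u) ≤
          |(∑ j : Fin m, wt (y ⟨(r : ℕ) * m + j, mul_add_lt hRm r j⟩ ω)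
                * O (y ⟨(r : ℕ) * m + j, mul_add_lt hRm r j⟩ ω))
              / (∑ j : Fin m, wt (y ⟨(r : ℕ) * m + j, mul_add_lt hRm r j⟩ ω))
            - ∫ z, p z * O z ∂μ|}
        ⊆ {ω | t ≤ |(∑ j : Fin m, p (y ⟨(r : ℕ) * m + j, mul_add_lt hRm r j⟩ ω)
              / q (y ⟨(r : ℕ) * m + j, mul_add_lt hRm r j⟩ ω)
              * O (y ⟨(r : ℕ) * m + j, mul_add_lt hRm r j⟩ ω)) / m - ∫ z, p z * O z ∂μ|}
          ∪ {ω | u ≤ |(∑ j : Fin m, p (y ⟨(r : ℕ) * m + j, mul_add_lt hRm r j⟩ ω)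
              / q (y ⟨(r : ℕ) * m + j, mul_add_lt hRm r j⟩ ω)) / m - 1|} := by
      intro ω hω
      simp only [Set.mem_setOf_eq, Set.mem_union] at hω ⊢
      rw [hratio ω] at hω
      by_contra hcon
      simp only [not_or, not_le] at hcon
      obtain ⟨h1, h2⟩ := hcon
      set A := (∑ j : Fin m, p (y ⟨(r : ℕ) * m + j, mul_add_lt hRm r j⟩ ω)
          / q (y ⟨(r : ℕ) * m + j, mul_add_lt hRm r j⟩ ω)
          * O (y ⟨(r : ℕ) * m + j, mul_add_lt hRm r j⟩ ω)) / m with hA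
      set W := (∑ j : Fin m, p (y ⟨(r : ℕ) * m + j, mul_add_lt hRm r j⟩ ω)
          / q (y ⟨(r : ℕ) * m + j, mul_add_lt hRm r j⟩ ω)) / m with hW'
      set a := ∫ z, p z * O z ∂μ with ha''
      have hWlo : 1 - u ≤ W := by
        have := (abs_lt.1 h2).1
        linarith
      have key : |A / W - a| ≤ (|A - a| + |a| * |W - 1|) / (1 - u) := by
        simpa only [div_one] using abs_div_sub_div_le (A := A) (B := W) (a := a) (b := 1)
          (β := 1 - u) (by linarith) hWlo one_ne_zero
      have hnum' : |A - a| + |a| * |W - 1| < t + B₁ * u := by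
        have h3 : |a| * |W - 1| ≤ B₁ * u :=
          mul_le_mul ha' h2.le (abs_nonneg _) hB0
        linarith
      have hlt : |A / W - a| < (t + B₁ * u) / (1 - u) :=
        key.trans_lt (div_lt_div_of_pos_right hnum' (by linarith))
      linarith
    have hE' : 40 * (∫ z, p z ^ (1 + ε) * |O z| ^ (1 + ε) / q z ^ ε ∂μ)
        / ((m : ℝ) ^ ε * t ^ (1 + ε)) ≤ 1 / 8 := by
      rw [div_le_iff₀ hDt]
      linarith
    have hW' : 5 * (∫ z, p z ^ (1 + ε) / q z ^ ε ∂μ) / ((m : ℝ) ^ ε * u ^ (1 + ε)) ≤ 1 / 8 := by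
      rw [div_le_iff₀ hDu]
      linarith
    calc P.real _ ≤ P.real _ := measureReal_mono hsub
      _ ≤ _ := measureReal_union_le _ _
      _ ≤ 1 / 8 + 1 / 8 := add_le_add (hE.trans hE') (hW.trans hW')
      _ = 1 / 4 := by norm_num
  have h := measureReal_half_far_le (μ := P) (univ : Finset (Fin R)) hYind hYm
    (∫ z, p z * O z ∂μ) ((t + B₁ * u) / (1 - u)) hfar
  simpa only [card_univ, Fintype.card_fin] using h

/-- **The same for ANY sample-median selection** `med(ω)` of the `R` printed block estimates:
`P((t + B₁u)/(1 − u) ≤ |med − ∫ p·O dμ|) ≤ exp(−R/8)`. [ours] -/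
theorem selfNormReweighting_sampleMedian_confidence_heavyTail_unbounded {y : Fin n → Ω → X}
    (hym : ∀ j, Measurable (y j)) (hind : iIndepFun y P) (hp0 : ∀ z, 0 ≤ p z)
    (hpm : Measurable p) (hpi : Integrable p μ) (hp1 : ∫ z, p z ∂μ = 1) (hq0 : ∀ z, 0 < q z)
    (hqm : Measurable q) (hOm : Measurable O) (hε0 : 0 < ε) (hε1 : ε ≤ 1)
    (hA1i : Integrable (fun z => p z ^ (1 + ε) / q z ^ ε) μ)
    (hAOi : Integrable (fun z => p z ^ (1 + ε) * |O z| ^ (1 + ε) / q z ^ ε) μ) {B₁ : ℝ}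
    (hB₁ : ∫ z, p z * |O z| ∂μ ≤ B₁)
    (hlaw : ∀ j, Measure.map (y j) P = μ.withDensity fun z => ENNReal.ofReal (q z))
    {wt : X → ℝ} {c : ℝ} (hc : 0 < c) (hwt : ∀ z, wt z = c * (p z / q z))
    (hm : 1 ≤ m) (hRm : R * m ≤ n) {t u : ℝ} (ht : 0 < t) (hu : 0 < u) (hu1 : u < 1)
    (hvt : 320 * ∫ z, p z ^ (1 + ε) * |O z| ^ (1 + ε) / q z ^ ε ∂μ ≤ (m : ℝ) ^ ε * t ^ (1 + ε))
    (hvu : 40 * ∫ z, p z ^ (1 + ε) / q z ^ ε ∂μ ≤ (m : ℝ) ^ ε * u ^ (1 + ε)) {med : Ω → ℝ}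
    (hlo : ∀ ω, (R : ℝ) / 2 ≤ #{r ∈ (univ : Finset (Fin R)) | med ω ≤
        (∑ j : Fin m, wt (y ⟨((r : Fin R) : ℕ) * m + j, mul_add_lt hRm r j⟩ ω)
              * O (y ⟨((r : Fin R) : ℕ) * m + j, mul_add_lt hRm r j⟩ ω))
            / (∑ j : Fin m, wt (y ⟨((r : Fin R) : ℕ) * m + j, mul_add_lt hRm r j⟩ ω))})
    (hhi : ∀ ω, (R : ℝ) / 2 ≤ #{r ∈ (univ : Finset (Fin R)) |
        (∑ j : Fin m, wt (y ⟨((r : Fin R) : ℕ) * m + j, mul_add_lt hRm r j⟩ ω)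
              * O (y ⟨((r : Fin R) : ℕ) * m + j, mul_add_lt hRm r j⟩ ω))
            / (∑ j : Fin m, wt (y ⟨((r : Fin R) : ℕ) * m + j, mul_add_lt hRm r j⟩ ω))
          ≤ med ω}) :
    P.real {ω | (t + B₁ * u) / (1 - u) ≤ |med ω - ∫ z, p z * O z ∂μ|} ≤ exp (-(R / 8)) := by
  refine (measureReal_mono ?_).trans
    (selfNormReweighting_medianOfBlocks_confidence_heavyTail_unbounded hym hind hp0 hpm hpi hp1
      hq0 hqm hOm hε0 hε1 hA1i hAOi hB₁ hlaw hc hwt hm hRm ht hu hu1 hvt hvu)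
  intro ω hω
  simp only [Set.mem_setOf_eq] at hω ⊢
  by_contra hlt
  push Not at hlt
  have hR : (#(univ : Finset (Fin R)) : ℝ) = R := by rw [card_univ, Fintype.card_fin]
  have h := abs_median_sub_lt_of_card_lt (univ : Finset (Fin R)) _ (hR ▸ hlo ω) (hR ▸ hhi ω)
    (hR ▸ hlt)
  linarith

end Certificate

end Summit.Ventures.LatticeQCDFlow.Scoring.HeavyTailMedian

end
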